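import Summits.QuantumFields.YangMills.Theorems.IR.AfPincerUcTypChainReduced
import HarnessLib

/-!
# Crux `IR` (stmt-QuantumFields-19354), line `af-pincer-Uc-sharp` — NEGATIVE side of conjunct (ii), part 2/2:
# the flux-edge-chain WIRE (uniform in the mesh) and what it costs every `TypChain` supplier

Negative knowledge for item `stmt-QuantumFields-19354` (`--supports`; closes no stub; the item's verdict of record stays NOT-REFUTED).
Author: refuter `ym-19354-disprove-1` GEN 11, answering the LEAD `ym-lead-19354-af-pincer` g3's closing ask W3 (NO-SUCCESSOR
2026-08-27T18:11:52Z): the requested `H → ¬(ii)` shape with `H` the LEAD's scenario typed UNIFORMLY IN THE MESH.  Independent of part 1/2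
(`ClauseIITypChainFalseOfGroundStateChains.lean`: the kernel Laplace engine and the FIXED-FRAME kills from chained ground states, which
discharge the wire's fixed-frame instances).

## What is PROVED here (no `sorry`; axioms ⊆ {propext, Classical.choice, Quot.sound})
* §4 `FluxEdgeChainWire ρ θ ℓ₀` (from some `β₀` on, at EVERY mesh `b ≥ 1` some mesh-`b` frame has a cell and a guard-clean exterior under
  which the cell's DLR kernel gives mass `> 1/2` to long `θ`-bad chains inside the cell) ⇒ at every mesh some frame violates
  `ClauseIIukp ρ β w δ (TypChain ρ θ w ℓ₀)` for every `δ ≤ 1/2` (`not_clauseIIukp_typChain_of_mass`, `exists_frame_not_clauseIIukp_of_wire`).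
* §5 SUPPLIER CALIBRATION (by name): every witness of `TypChainSharpSC` prints `(θ, ℓ₀)` with `¬ FluxEdgeChainWire r.ρ θ ℓ₀`
  (`typChainSharpSC_avoids_wire`); every witness of `TypChainReducedAtSC` prints `(θ, κ, C)` with `¬ FluxEdgeChainWire r.ρ θ (extentOf θ κ C)`
  (`typChainReducedAtSC_avoids_wire`, through `clauses_typChain_extentOf`).  So a supplier of either format at a threshold INSIDE the
  wire (numerically `θ ≲ 0.3` for `SU(2)`, FORCING-NUMERICS-g3 rev 2 §4 (6)) would thereby DISPROVE the wire: the printed `θ` must sit above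
  the forcing level (`θ_force(SU(2)) ≈ 0.36`; the LEAD's `θ ≥ 1/2` is consistent).

## What is NOT proved
The wire.  Its fixed-frame instances follow from chained ground states (part 1/2, `kernel_typChain_le_of_groundStatesChained_at`); the
uniformity in the mesh `b` (thermal stability of a forced edge chain in a cell of side `b → ∞` at fixed `β`) is the open, load-bearing part.
Nothing here refutes `TypChainSharpSC`, `OnsetSharpUKPcSC` or `IR`.  Not a mass gap; not Clay.
-/

set_option autoImplicit false

noncomputable section

open MeasureTheory Filter Topology
open Literature.MathematicalPhysics.QuantumFieldTheory hiding ZdEdge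
open Literature.MathematicalPhysics.QuantumLattice
open Literature.Probability.LatticeModels
open Summit.QuantumFields.YangMills.Cruxes.IR.Tempered (cellEdges regionEdges)
open Summit.QuantumFields.YangMills.Theorems.OddTorusChessboard (cellPlaqs plaqAction plaqAction_congr measurable_plaqAction)

namespace Summit.QuantumFields.YangMills.Cruxes.IR.AfPincerUc.SharpLanes.FluxEdgeChain

open Summit.QuantumFields.YangMills.Cruxes.IR.AfPincerUc
open Summit.QuantumFields.YangMills.Cruxes.IR.AfPincerUc.SharpLanes

/-! ## §4 The flux-edge-chain WIRE (uniform in the mesh) and what it costs every `TypChain` supplier -/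
section Wire

variable {G : Type} [Group G] [TopologicalSpace G] [IsTopologicalGroup G] [CompactSpace G]
  [MeasurableSpace G] [BorelSpace G]

/-- **The flux-edge-chain wire at `(θ, ℓ₀)`** for the Wilson kernels of `ρ` — the LEAD's W3 scenario (NO-SUCCESSOR 2026-08-27T18:11:52Z; uniform
sub-threshold flux exterior, edge chains, `θ ≲ 0.3`) typed UNIFORMLY IN THE MESH: from some coupling `β₀` on, at EVERY mesh `b ≥ 1` some
mesh-`b` frame `w` has a cell `c` and an exterior `ζ`, short-chain typical on the `3⁴ − 1` cells around `c` (the format's guard), under which the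
cell's DLR kernel gives mass `> 1/2` to configurations carrying a `θ`-bad chain of extent `≥ ℓ₀` INSIDE the cell.  Part 1/2 proves its fixed-frame
instances from chained ground states (`GroundStateForcing.kernel_typChain_le_of_groundStatesChained_at`); the uniformity in `b` (thermal stability of the forced
edge chain in cells of side `b → ∞` at fixed `β`) is the open, load-bearing part and is NOT proved here. -/
def FluxEdgeChainWire {N : ℕ} (ρ : G →* Matrix (Fin N) (Fin N) ℂ) (θ : ℝ) (ℓ₀ : ℕ) : Prop :=
  ∃ β₀ : ℝ, ∀ β : ℝ, β₀ ≤ β → ∀ b : ℕ, 1 ≤ b → ∃ w : Fin 4 → ℤ → ℤ, IsFrame b w ∧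
    ∃ (c : Fin 4 → ℤ) (ζ : LGConfig 4 G), (∀ c' : Fin 4 → ℤ, c' ≠ c → (∀ i, |c' i - c i| ≤ 1) → ζ ∈ TypChain ρ θ w ℓ₀ c') ∧
      ENNReal.ofReal (1 / 2) < (ymSpecification ρ β (regionEdges w {c}) ζ) (TypChain ρ θ w ℓ₀ c)ᶜ

variable {N : ℕ} (ρ : G →* Matrix (Fin N) (Fin N) ℂ)

/-- **Kernel mass `> 1/2` on long chains under a guard-clean exterior refutes clause (ii) for every budget `δ ≤ 1/2` (PROVED)** — the
one-cell instance `F = F' = {c}` of `ClauseIIukp`. -/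
theorem not_clauseIIukp_typChain_of_mass {β θ : ℝ} {w : Fin 4 → ℤ → ℤ} {ℓ₀ : ℕ} {c : Fin 4 → ℤ} {ζ : LGConfig 4 G}
    (hguard : ∀ c' : Fin 4 → ℤ, c' ≠ c → (∀ i, |c' i - c i| ≤ 1) → ζ ∈ TypChain ρ θ w ℓ₀ c')
    (hmass : ENNReal.ofReal (1 / 2) < (ymSpecification ρ β (regionEdges w {c}) ζ) (TypChain ρ θ w ℓ₀ c)ᶜ) {δ : ℝ}
    (hδ : δ ≤ 1 / 2) : ¬ ClauseIIukp ρ β w δ (TypChain ρ θ w ℓ₀) := by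
  intro hII
  have hle := hII {c} {c} (Finset.Subset.refl _) (Finset.singleton_nonempty c) ζ
    (fun c₁ hc₁ c' hc' => by
      rw [Finset.mem_singleton.1 hc₁] at hc'
      by_cases h' : c' = c
      · exact Or.inl (Finset.mem_singleton.2 h')
      · exact Or.inr (hguard c' h' hc'))
  have hset : {σ : LGConfig 4 G | ∀ c₁ ∈ ({c} : Finset (Fin 4 → ℤ)), σ ∉ TypChain ρ θ w ℓ₀ c₁} = (TypChain ρ θ w ℓ₀ c)ᶜ := by
    ext σ; simp
  rw [hset, Finset.card_singleton, pow_one] at hle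
  exact (lt_irrefl _) ((hle.trans (ENNReal.ofReal_le_ofReal hδ)).trans_lt hmass)

/-- **The wire kills the per-frame (ii)-demand at EVERY mesh (PROVED):** under `FluxEdgeChainWire ρ θ ℓ₀`, for all large `β` and every mesh
`b ≥ 1` some mesh-`b` frame violates clause (ii) for `TypChain ρ θ w ℓ₀` at every budget `δ ≤ 1/2`. -/
theorem exists_frame_not_clauseIIukp_of_wire {θ : ℝ} {ℓ₀ : ℕ} (hW : FluxEdgeChainWire ρ θ ℓ₀) :
    ∃ β₀ : ℝ, ∀ β : ℝ, β₀ ≤ β → ∀ b : ℕ, 1 ≤ b → ∀ δ : ℝ, δ ≤ 1 / 2 →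
      ∃ w : Fin 4 → ℤ → ℤ, IsFrame b w ∧ ¬ ClauseIIukp ρ β w δ (TypChain ρ θ w ℓ₀) := by
  obtain ⟨β₀, h⟩ := hW
  refine ⟨β₀, fun β hβ b hb δ hδ => ?_⟩
  obtain ⟨w, hw, c, ζ, hguard, hmass⟩ := h β hβ b hb
  exact ⟨w, hw, not_clauseIIukp_typChain_of_mass ρ hguard hmass hδ⟩

end Wire

/-! ## §5 Supplier-level consequences: every `TypChain` supplier prints `(θ, ℓ₀)` OUTSIDE the wire -/
section Supplier

open Summit.QuantumFields.YangMills.Cruxes.OSLegsFromFemtoAndGap.DlrCollarTransfer (LowerBounds)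

/-- **Every witness of `TypChainSharpSC` avoids the wire (PROVED).**  At any SC datum `(G, r, a)` with `LowerBounds`, a supplier of
`TypChainSharpSC` must print `(n, ε, θ, ℓ₀)` with `¬ FluxEdgeChainWire r.ρ θ ℓ₀`: a supplier proving the format at a threshold INSIDE the wire
(numerically `θ ≲ 0.3` for `SU(2)`) would thereby refute the wire.  Calibration of the supplier's `θ`, not a refutation of the format. -/
theorem typChainSharpSC_avoids_wire (h : TypChainSharpSC) (G : Type) [Group G] [TopologicalSpace G] [IsTopologicalGroup G]
    [CompactSpace G] (hG : IsCompactSimpleLieGroup G) (hsc : SimplyConnectedSpace G) :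
    letI : MeasurableSpace G := borel G
    haveI : BorelSpace G := ⟨rfl⟩
    ∀ (r : LatticeRep G) (a : ℝ → ℝ), (∀ β, 0 < a β) → Tendsto a atTop (𝓝 0) → LowerBounds G r a →
      ∃ (n : ℕ) (ε : ℝ) (θ : ℝ) (ℓ₀ : ℕ), ¬ FluxEdgeChainWire r.ρ θ ℓ₀ ∧ 1 ≤ n ∧ 0 ≤ ε ∧ ε * OnsetFormats.shellCount n ≤ 3 / 4 ∧
        ∀ δ : ℝ, 0 < δ → ∃ T β₂ : ℝ, ∀ β : ℝ, β₂ ≤ β → ∃ b : ℕ, 1 ≤ b ∧ a β * (b : ℝ) < T ∧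
          ∀ w : Fin 4 → ℤ → ℤ, IsFrame b w →
            ClauseIAll r.ρ β w n ε (TypChain r.ρ θ w ℓ₀) ∧ ClauseIIukp r.ρ β w δ (TypChain r.ρ θ w ℓ₀) ∧
              ClauseIII r.ρ β w b δ (TypChain r.ρ θ w ℓ₀) := by
  letI : MeasurableSpace G := borel G
  haveI : BorelSpace G := ⟨rfl⟩
  intro r a ha hat hlb
  obtain ⟨n, ε, θ, ℓ₀, hn, hε, hM, hsup⟩ := h G hG hsc r a ha hat hlb
  refine ⟨n, ε, θ, ℓ₀, fun hW => ?_, hn, hε, hM, hsup⟩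
  obtain ⟨β₀, hβ₀⟩ := exists_frame_not_clauseIIukp_of_wire r.ρ hW
  obtain ⟨T, β₂, hβ₂⟩ := hsup (1 / 2) (by norm_num)
  obtain ⟨b, hb1, -, hframes⟩ := hβ₂ (max β₀ β₂) (le_max_right _ _)
  obtain ⟨w, hw, hnot⟩ := hβ₀ (max β₀ β₂) (le_max_left _ _) b hb1 (1 / 2) le_rfl
  exact hnot (hframes w hw).2.1

/-- **Every witness of the REDUCED supplier statement `TypChainReducedAtSC` avoids the wire at its served extent (PROVED):** the printed
`(θ, κ, C)` satisfy `¬ FluxEdgeChainWire r.ρ θ (extentOf θ κ C)` (kernel sparseness at base `e^{−κβ}` gives clause (ii) with budget `1/2` on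
every frame of the supplier's mesh, `clauses_typChain_extentOf`; the wire denies it on one of them). -/
theorem typChainReducedAtSC_avoids_wire (h : TypChainReducedAtSC) (G : Type) [Group G] [TopologicalSpace G] [IsTopologicalGroup G]
    [CompactSpace G] (hG : IsCompactSimpleLieGroup G) (hsc : SimplyConnectedSpace G) :
    letI : MeasurableSpace G := borel G
    haveI : BorelSpace G := ⟨rfl⟩
    ∀ (r : LatticeRep G) (a : ℝ → ℝ), (∀ β, 0 < a β) → Tendsto a atTop (𝓝 0) → LowerBounds G r a →
      ∃ (n : ℕ) (ε θ κ C : ℝ), ¬ FluxEdgeChainWire r.ρ θ (extentOf θ κ C) ∧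
        1 ≤ n ∧ 0 ≤ ε ∧ ε * OnsetFormats.shellCount n ≤ 3 / 4 ∧ 0 < θ ∧ 0 < κ ∧
        ∀ δ : ℝ, 0 < δ → ∃ T B β₂ : ℝ, ∀ β : ℝ, β₂ ≤ β →
          ∃ b : ℕ, 1 ≤ b ∧ a β * (b : ℝ) < T ∧ (b : ℝ) ≤ B * Real.exp (C * β) ∧
            ∀ w : Fin 4 → ℤ → ℤ, IsFrame b w →
              ClauseIAll r.ρ β w n ε (TypChain r.ρ θ w (extentOf θ κ C)) ∧
                KernelPlaqSparse r.ρ β w θ (extentOf θ κ C) (Real.exp (-(κ * β))) := by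
  letI : MeasurableSpace G := borel G
  haveI : BorelSpace G := ⟨rfl⟩
  intro r a ha hat hlb
  obtain ⟨n, ε, θ, κ, C, hn, hε, hM, hθ, hκ, hsup⟩ := h G hG hsc r a ha hat hlb
  refine ⟨n, ε, θ, κ, C, fun hW => ?_, hn, hε, hM, hθ, hκ, hsup⟩
  obtain ⟨β₀, hβ₀⟩ := exists_frame_not_clauseIIukp_of_wire r.ρ hW
  obtain ⟨T, B, β₂, hβ₂⟩ := hsup (1 / 2) (by norm_num)
  obtain ⟨β₂', hβ₂'⟩ := clauses_typChain_extentOf (G := G) r hθ hκ C (1 / 2) (by norm_num) B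
  set β := max β₀ (max β₂ β₂') with hβdef
  obtain ⟨b, hb1, -, hbB, hframes⟩ := hβ₂ β (le_trans (le_max_left _ _) (le_max_right _ _))
  obtain ⟨w, hw, hnot⟩ := hβ₀ β (le_max_left _ _) b hb1 (1 / 2) le_rfl
  exact hnot ((hβ₂' β (le_trans (le_max_right _ _) (le_max_right _ _)) b hb1 hbB w hw).1 (hframes w hw).2)

end Supplier

end Summit.QuantumFields.YangMills.Cruxes.IR.AfPincerUc.SharpLanes.FluxEdgeChain

end
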